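import Summits.CriticalPhenomena.CardyFormulaZ2.Theorems.CardyMeckeFlipMeckeRigidityCampbellIntegrand
import Summits.CriticalPhenomena.CardyFormulaZ2.Theorems.CardyMeckeFlipMeckeRigidityPivotalSection

/-!
# The flip identity certifies its own measurability: the toggled Campbell integrand is in `L¹(P)`

Route `Summits/CriticalPhenomena/CardyFormulaZ2/Theses/CardyMeckeFlip`, crux `MeckeRigidity`
(item stmt-CriticalPhenomena-14826), line `registered`, stub `stub_crossingUniqueness` (helpers).

Clause (F) (`IsFlipFairKernel P (M ε)`) equates, for every datum `(n, Q, g, φ)`, the Bochner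
integrals over `P` of the un-toggled integrand `L(S) = ∫ φ(x) g({i | Qᵢ ∈ S}) M ε S(dx)` and of the
toggled one `R(S) = ∫ φ(x) g({i | Qᵢ ∈ S} Δ {i | Piv S x Qᵢ}) M ε S(dx)`.  The pivotal predicate is
only co-analytic jointly in `(S, x)`, so `R` is not obviously measurable in `S` (refuter notes on the
item; lead memo of the sibling crux FlipErgodicityZ2, §R2).  This file shows that no extra
hypothesis is needed on the CONSUMER side of (F): under (ADM) the identity (F) itself forces `R` to
be a.e. strongly measurable, hence (dominated by the local mass of the kernel) in `L¹(P)`: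

* for `φ ≥ 0`, if `R` were not a.e. strongly measurable then neither would be its shifts under
  `g ↦ g + C` (they differ from `R` by `C · ∫ φ dM ε S`, an honest measurable function), all their
  Bochner integrals would be the junk value `0`, and (F) applied to `g` and `g + 1` would give
  `∫∫ φ dM ε S dP = 0`, i.e. `R = 0` a.s. — a contradiction
  (`aestronglyMeasurable_toggledIntegrand_of_nonneg`);
* general `φ` by `φ = φ⁺ − φ⁻` (`aestronglyMeasurable_toggledIntegrand`), and integrability
  (`integrable_toggledIntegrand`; registered `∀`-form `integrable_flipFairIntegrand_right`).

Inputs: x-sections of `IsPivotalAt` are Borel (`measurableSet_isPivotalAt`, so the inner integrals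
split), kernel bookkeeping of `…CampbellIntegrand`.
-/

noncomputable section

open MeasureTheory Set Metric Filter Topology ProbabilityTheory
open scoped ENNReal NNReal
open Literature.Probability.Percolation Literature.Probability.Percolation.QuadCrossing

namespace Summit.CriticalPhenomena.CardyFormulaZ2.Theorems.CardyMeckeFlip

variable {D : Set ℂ}

/-! ### The toggled pattern is measurable in `x` -/

/-- **The toggled pattern is a measurable function of the point** (for fixed configuration and
family of quads): each `{x | S.IsPivotalAt x (Q i)}` is Borel. [folklore] -/
theorem measurable_comp_toggledPattern
    {β : Type*} [MeasurableSpace β] {n : ℕ} (S : QuadConfig D) (Q : Fin n → Quad D)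
    (g : Set (Fin n) → β) :
    Measurable fun x : ℂ => g {i | Xor (Q i ∈ S) (S.IsPivotalAt x (Q i))} := by
  have hpat : Measurable fun x : ℂ => {i | Xor (Q i ∈ S) (S.IsPivotalAt x (Q i))} := by
    refine measurable_set_iff.2 fun i => measurableSet_setOf.1 ?_
    change MeasurableSet {x : ℂ | Xor (Q i ∈ S) (S.IsPivotalAt x (Q i))}
    by_cases hQ : Q i ∈ S
    · have : {x : ℂ | Xor (Q i ∈ S) (S.IsPivotalAt x (Q i))} = {x | S.IsPivotalAt x (Q i)}ᶜ := by
        ext x; simp [Xor, hQ]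
      rw [this]
      exact (measurableSet_isPivotalAt S (Q i)).compl
    · have : {x : ℂ | Xor (Q i ∈ S) (S.IsPivotalAt x (Q i))} = {x | S.IsPivotalAt x (Q i)} := by
        ext x; simp [Xor, hQ]
      rw [this]
      exact measurableSet_isPivotalAt S (Q i)
  exact (measurable_of_countable g).comp hpat

/-! ### Inner integrability on locally finite configurations -/

/-- A continuous function vanishing off a set of finite mass is integrable. [folklore] -/
theorem integrable_of_eq_zero_off {μ : Measure ℂ} {φ : ℂ → ℝ} (hφ : Continuous φ) {K : Set ℂ}
    (hK : μ K < ∞) (hoff : ∀ x, x ∉ K → φ x = 0) {C : ℝ} (hC : ∀ x, ‖φ x‖ ≤ C) :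
    Integrable φ μ := by
  have hsupp : Function.support φ ⊆ K := fun x hx => by
    by_contra hxK
    exact hx (hoff x hxK)
  rw [← integrableOn_iff_integrable_of_support_subset hsupp]
  exact Measure.integrableOn_of_bounded hK.ne hφ.aestronglyMeasurable
    (Eventually.of_forall fun x => hC x)

/-- On a configuration whose kernel is finite on the ball carrying `φ`, the toggled inner
integrand `x ↦ φ(x) g(toggled pattern)` is integrable. [folklore] -/
theorem integrable_mul_toggledPattern
    {μ : Measure ℂ} {φ : ℂ → ℝ} (hφ : Continuous φ) {K : Set ℂ} (hK : μ K < ∞)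
    (hoff : ∀ x, x ∉ K → φ x = 0) {C : ℝ} (hC : ∀ x, ‖φ x‖ ≤ C) {n : ℕ} (S : QuadConfig D)
    (Q : Fin n → Quad D) (g : Set (Fin n) → ℝ) :
    Integrable (fun x => φ x * g {i | Xor (Q i ∈ S) (S.IsPivotalAt x (Q i))}) μ := by
  obtain ⟨Cg, -, hCg⟩ := exists_forall_abs_le_of_pattern g
  refine (integrable_of_eq_zero_off hφ hK hoff hC).mul_bdd (c := Cg)
    (measurable_comp_toggledPattern S Q g).aestronglyMeasurable
    (Eventually.of_forall fun x => ?_)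
  rw [Real.norm_eq_abs]
  exact hCg _

/-! ### (F) forces the toggled integrand to be a.e. strongly measurable -/

/-- **Self-certifying measurability of (F), nonnegative test functions.**  Under (ADM) and the
flip identity (F) at cutoff `ε`, for `φ ≥ 0` the toggled outer integrand
`S ↦ ∫ φ(x) g(toggled pattern) M ε S(dx)` is a.e. strongly measurable: otherwise all its Bochner
integrals — and those of its shifts `g ↦ g + C`, which differ from it by `C · ∫ φ dM ε S` — would
be the junk value `0`, and (F) would force `∫∫ φ dM dP = 0`, i.e. the integrand to vanish a.s.
[folklore] -/
theorem aestronglyMeasurable_toggledIntegrand_of_nonneg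
    {P : Measure (QuadConfig D)} {M : ℝ → QuadConfig D → Measure ℂ} (hADM : IsAdmissibleKernel P M)
    {ε : ℝ} (hε : 0 < ε) (hF : IsFlipFairKernel P (M ε)) {n : ℕ} (Q : Fin n → Quad D)
    (g : Set (Fin n) → ℝ) {φ : ℂ → ℝ} (hφ : Continuous φ) (hφc : HasCompactSupport φ)
    (hφ0 : ∀ x, 0 ≤ φ x) :
    AEStronglyMeasurable
      (fun S => ∫ x, φ x * g {i | Xor (Q i ∈ S) (S.IsPivotalAt x (Q i))} ∂(M ε S)) P := by
  by_contra hnot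
  obtain ⟨r, hr⟩ := exists_nat_eq_zero_off_closedBall hφc
  obtain ⟨Cφ, hCφ⟩ := hφ.bounded_above_of_compact_support hφc
  -- a.s. the kernel is finite on the ball carrying `φ`
  have hgood : ∀ᵐ S ∂P, M ε S (closedBall 0 r) < ∞ :=
    (ae_kernel_closedBall_lt_top hADM hε).mono fun S h => h r
  -- the total mass functional `m(S) = ∫ φ dM ε S`: measurable, integrable, nonnegative
  have hm_sm : StronglyMeasurable fun S => ∫ x, φ x ∂(M ε S) :=
    stronglyMeasurable_kernel_integral (hADM.measurable ε) hφ.stronglyMeasurable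
  have hm_int : Integrable (fun S => ∫ x, φ x ∂(M ε S)) P := by
    have := integrable_patternIntegrand hADM hε Q (fun _ => (1 : ℝ)) hφ hφc
    simpa only [mul_one] using this
  have hLg_int : Integrable (fun S => ∫ x, φ x * g {i | Q i ∈ S} ∂(M ε S)) P :=
    integrable_patternIntegrand hADM hε Q g hφ hφc
  -- shifting `g` by a constant shifts the toggled integrand by `C · m` (a.s.) …
  have hRC : ∀ C : ℝ,
      (fun S => ∫ x, φ x * (g {i | Xor (Q i ∈ S) (S.IsPivotalAt x (Q i))} + C) ∂(M ε S)) =ᵐ[P]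
        fun S => (∫ x, φ x * g {i | Xor (Q i ∈ S) (S.IsPivotalAt x (Q i))} ∂(M ε S)) +
          C * ∫ x, φ x ∂(M ε S) := by
    intro C
    filter_upwards [hgood] with S hS
    have e : (fun x => φ x * (g {i | Xor (Q i ∈ S) (S.IsPivotalAt x (Q i))} + C)) =
        fun x => φ x * g {i | Xor (Q i ∈ S) (S.IsPivotalAt x (Q i))} + C * φ x := by
      funext x; ring
    rw [e, integral_add (integrable_mul_toggledPattern hφ hS hr hCφ S Q g)
      ((integrable_of_eq_zero_off hφ hS hr hCφ).const_mul C), integral_const_mul]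
  -- … and the un-toggled integrand by `C · m` (everywhere)
  have hLC : ∀ (C : ℝ) (S : QuadConfig D),
      ∫ x, φ x * (g {i | Q i ∈ S} + C) ∂(M ε S) =
        (∫ x, φ x * g {i | Q i ∈ S} ∂(M ε S)) + C * ∫ x, φ x ∂(M ε S) := by
    intro C S
    rw [integral_mul_const, integral_mul_const]
    ring
  -- no shift is a.e. strongly measurable
  have hnotC : ∀ C : ℝ, ¬ AEStronglyMeasurable
      (fun S => ∫ x, φ x * (g {i | Xor (Q i ∈ S) (S.IsPivotalAt x (Q i))} + C) ∂(M ε S)) P := by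
    intro C hC
    apply hnot
    have hae : (fun S => ∫ x, φ x * g {i | Xor (Q i ∈ S) (S.IsPivotalAt x (Q i))} ∂(M ε S)) =ᵐ[P]
        fun S => (∫ x, φ x * (g {i | Xor (Q i ∈ S) (S.IsPivotalAt x (Q i))} + C) ∂(M ε S)) -
          C * ∫ x, φ x ∂(M ε S) := by
      filter_upwards [hRC C] with S hS
      rw [hS]
      ring
    exact (hC.sub (hm_sm.aestronglyMeasurable.const_mul C)).congr hae.symm
  -- so all their integrals vanish, and by (F) so do those of the shifted un-toggled integrands
  have hLint0 : ∀ C : ℝ, ∫ S, ∫ x, φ x * g {i | Q i ∈ S} ∂(M ε S) ∂P +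
      C * ∫ S, ∫ x, φ x ∂(M ε S) ∂P = 0 := by
    intro C
    have h1 := hF n Q (fun A => g A + C) φ hφ hφc
    rw [integral_non_aestronglyMeasurable (hnotC C)] at h1
    simp_rw [hLC C] at h1
    rwa [integral_add hLg_int (hm_int.const_mul C), integral_const_mul] at h1
  have hm0 : ∫ S, ∫ x, φ x ∂(M ε S) ∂P = 0 := by
    have h0 := hLint0 0
    have h1 := hLint0 1
    rw [zero_mul, add_zero] at h0
    rwa [h0, zero_add, one_mul] at h1
  -- `m ≥ 0`, so `m = 0` a.s.; where `m S = 0` the measure `M ε S` does not see `φ`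
  have hm_ae : (fun S => ∫ x, φ x ∂(M ε S)) =ᵐ[P] 0 :=
    (integral_eq_zero_iff_of_nonneg (fun S => integral_nonneg fun x => hφ0 x) hm_int).1 hm0
  have hR0 : (fun S => ∫ x, φ x * g {i | Xor (Q i ∈ S) (S.IsPivotalAt x (Q i))} ∂(M ε S)) =ᵐ[P]
      fun _ => (0 : ℝ) := by
    filter_upwards [hgood, hm_ae] with S hS hmS
    have hφae : φ =ᵐ[M ε S] 0 :=
      (integral_eq_zero_iff_of_nonneg (fun x => hφ0 x) (integrable_of_eq_zero_off hφ hS hr hCφ)).1 hmS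
    refine integral_eq_zero_of_ae ?_
    filter_upwards [hφae] with x hx
    simp [hx]
  exact hnot (aestronglyMeasurable_const.congr hR0.symm)

/-- **Self-certifying measurability of (F)**: under (ADM) and the flip identity (F) at cutoff
`ε`, the toggled outer integrand of (F) is a.e. strongly measurable for every test function
(split `φ = φ⁺ − φ⁻`). [folklore] -/
theorem aestronglyMeasurable_toggledIntegrand
    {P : Measure (QuadConfig D)} {M : ℝ → QuadConfig D → Measure ℂ} (hADM : IsAdmissibleKernel P M)
    {ε : ℝ} (hε : 0 < ε) (hF : IsFlipFairKernel P (M ε)) {n : ℕ} (Q : Fin n → Quad D)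
    (g : Set (Fin n) → ℝ) {φ : ℂ → ℝ} (hφ : Continuous φ) (hφc : HasCompactSupport φ) :
    AEStronglyMeasurable
      (fun S => ∫ x, φ x * g {i | Xor (Q i ∈ S) (S.IsPivotalAt x (Q i))} ∂(M ε S)) P := by
  obtain ⟨r, hr⟩ := exists_nat_eq_zero_off_closedBall hφc
  obtain ⟨Cφ, hCφ⟩ := hφ.bounded_above_of_compact_support hφc
  have hgood : ∀ᵐ S ∂P, M ε S (closedBall 0 r) < ∞ :=
    (ae_kernel_closedBall_lt_top hADM hε).mono fun S h => h r
  -- positive and negative parts: continuous, compactly supported, nonnegative, vanishing off the ball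
  have hpc : Continuous fun x => max (φ x) 0 := hφ.max continuous_const
  have hnc : Continuous fun x => max (-φ x) 0 := hφ.neg.max continuous_const
  have hps : HasCompactSupport fun x => max (φ x) 0 :=
    hφc.mono (Function.support_subset_iff'.2 fun x hx => by
      rw [Function.notMem_support.1 hx, max_self])
  have hns : HasCompactSupport fun x => max (-φ x) 0 :=
    hφc.mono (Function.support_subset_iff'.2 fun x hx => by
      rw [Function.notMem_support.1 hx, neg_zero, max_self])
  have hpr : ∀ x, x ∉ closedBall (0 : ℂ) r → max (φ x) 0 = 0 := fun x hx => by
    rw [hr x hx, max_self]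
  have hnr : ∀ x, x ∉ closedBall (0 : ℂ) r → max (-φ x) 0 = 0 := fun x hx => by
    rw [hr x hx, neg_zero, max_self]
  have hpb : ∀ x, ‖max (φ x) 0‖ ≤ Cφ := fun x => by
    rw [Real.norm_eq_abs, abs_of_nonneg (le_max_right _ _)]
    exact max_le ((le_abs_self _).trans (Real.norm_eq_abs _ ▸ hCφ x))
      ((abs_nonneg _).trans (Real.norm_eq_abs _ ▸ hCφ x))
  have hnb : ∀ x, ‖max (-φ x) 0‖ ≤ Cφ := fun x => by
    rw [Real.norm_eq_abs, abs_of_nonneg (le_max_right _ _)]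
    exact max_le ((neg_le_abs _).trans (Real.norm_eq_abs _ ▸ hCφ x))
      ((abs_nonneg _).trans (Real.norm_eq_abs _ ▸ hCφ x))
  have hP := aestronglyMeasurable_toggledIntegrand_of_nonneg hADM hε hF Q g hpc hps
    fun x => le_max_right _ _
  have hN := aestronglyMeasurable_toggledIntegrand_of_nonneg hADM hε hF Q g hnc hns
    fun x => le_max_right _ _
  have hae : (fun S => ∫ x, φ x * g {i | Xor (Q i ∈ S) (S.IsPivotalAt x (Q i))} ∂(M ε S)) =ᵐ[P]
      fun S => (∫ x, max (φ x) 0 * g {i | Xor (Q i ∈ S) (S.IsPivotalAt x (Q i))} ∂(M ε S)) -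
        ∫ x, max (-φ x) 0 * g {i | Xor (Q i ∈ S) (S.IsPivotalAt x (Q i))} ∂(M ε S) := by
    filter_upwards [hgood] with S hS
    rw [← integral_sub (integrable_mul_toggledPattern hpc hS hpr hpb S Q g)
      (integrable_mul_toggledPattern hnc hS hnr hnb S Q g)]
    congr 1
    funext x
    rw [← sub_mul, max_zero_sub_max_neg_zero_eq_self]
  exact (hP.sub hN).congr hae.symm

/-- **The toggled integrand of (F) is in `L¹(P)`** under (ADM) + (F): a.e. strong measurability
from the self-certifying argument, domination by the local mass of the kernel. [folklore] -/
theorem integrable_toggledIntegrand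
    {P : Measure (QuadConfig D)} {M : ℝ → QuadConfig D → Measure ℂ} (hADM : IsAdmissibleKernel P M)
    {ε : ℝ} (hε : 0 < ε) (hF : IsFlipFairKernel P (M ε)) {n : ℕ} (Q : Fin n → Quad D)
    (g : Set (Fin n) → ℝ) {φ : ℂ → ℝ} (hφ : Continuous φ) (hφc : HasCompactSupport φ) :
    Integrable (fun S => ∫ x, φ x * g {i | Xor (Q i ∈ S) (S.IsPivotalAt x (Q i))} ∂(M ε S)) P := by
  obtain ⟨C, r, hCr⟩ := ae_norm_toggledIntegrand_le hADM hε g hφ hφc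
    fun S x => {i | Xor (Q i ∈ S) (S.IsPivotalAt x (Q i))}
  exact integrable_of_norm_le_kernel_closedBall hADM hε
    (aestronglyMeasurable_toggledIntegrand hADM hε hF Q g hφ hφc) C r hCr

/-- **Registered form** (sub-goal `integrable_flipFairIntegrand_right` of item
stmt-CriticalPhenomena-14826): under (ADM) and (F) at cutoff `ε > 0`, the toggled (right-hand)
integrand of the flip identity is `P`-integrable for every datum. [folklore] -/
theorem integrable_flipFairIntegrand_right : ∀ (D : Set ℂ) (P : Measure (QuadConfig D)) (M : ℝ → QuadConfig D → Measure ℂ), IsAdmissibleKernel P M → ∀ ε : ℝ, 0 < ε → IsFlipFairKernel P (M ε) → ∀ (n : ℕ) (Q : Fin n → Quad D) (g : Set (Fin n) → ℝ) (φ : ℂ → ℝ), Continuous φ → HasCompactSupport φ → Integrable (fun S => ∫ x, φ x * g {i | Xor (Q i ∈ S) (S.IsPivotalAt x (Q i))} ∂(M ε S)) P := by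
  intro D P M hADM ε hε hF n Q g φ hφ hφc
  exact integrable_toggledIntegrand hADM hε hF Q g hφ hφc

end Summit.CriticalPhenomena.CardyFormulaZ2.Theorems.CardyMeckeFlip

end
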